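import Mathlib
import Summits.KontsevichZagierPeriods.Zeta5Search.Certificates.RecordRayPhatData
import HarnessLib

/-! # Record ray, (N) for every `n ≥ 1` — G1. cone-step forms and the positivity certificate format (S4-R1 item #10, step N-3)

Integer list polynomials (constant term first) with their semantics under `hornerG` (`addP`, `smulP`, `mulXP`, Taylor shift
`shift1P`, `sq1P`), the CERTIFICATE `certPos p` ("all Taylor coefficients at `1` are `≥ 0` and `p(1) > 0`", hence `p > 0` on
`[1, ∞)`), and the six forms of the cone step: with `z = P̂(ν)·(1, −r₁ν², r₁r₂ν⁴)`, membership of `z` in the box at `ν + 1`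
is `−z₀ > 0`, `z₁ > 0`, `z₁ + 99(ν+1)²z₀ ≥ 0`, `−z₁ − 100(ν+1)²z₀ ≥ 0`, `−z₂ − 80(ν+1)²z₁ ≥ 0`, `z₂ + 100(ν+1)²z₁ ≥ 0`; each form is
affine-bilinear in `(r₁, r₁r₂)`.  The kernel certificates and the cone step itself are in `RecordRayCone`.

Provenance: gen-2 g32's kernel-checked scratch `AllN_G15.lean` (2026-08-22, rc 0 / 0 sorry, axioms propext ·
Classical.choice · Quot.sound), built on fam-tele g15's generic record-ray interface (`RecordRayGenericForms/Steps`,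
`RecordRayMirror`, `RecordRayRaySteps`, `RecordRayChain`, all in the tree); data from gen-2 g31 (`P̂`, align) and fam-tele
g14 (`conn/PATH.md`).  Staged for the tree by gen-2 g33 (S4-R1 item #10).

HONEST FRAMING: systematic search; no irrationality claim unless certified; this is clause (N) of Brown–Zudilin's Theorem 1
(arXiv:2210.03391) for THEIR OWN record cell — the non-vanishing of their linear forms — and nothing about ζ(5) beyond that;
records UNMOVED. -/

namespace Summit.KontsevichZagierPeriods.Zeta5Search.RecordRay.Generic

open Matrix

section Cone
variable {R : Type*} [CommRing R]

/-! #### G.1 integer list polynomials (constant term first) and their semantics under `hornerG` -/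

/-- Sum of two integer coefficient lists (constant term first). -/
def addP : List ℤ → List ℤ → List ℤ
  | [], q => q
  | a :: p, [] => a :: p
  | a :: p, b :: q => (a + b) :: addP p q

/-- Scalar multiple of an integer coefficient list. -/
def smulP (c : ℤ) (p : List ℤ) : List ℤ := p.map (fun a => c * a)

/-- `X · p`. -/
def mulXP (p : List ℤ) : List ℤ := 0 :: p

/-- Taylor shift `p(X + 1)` (Horner: `a + (X+1)·q = [a] + q + X q`). -/
def shift1P (p : List ℤ) : List ℤ := p.foldr (fun a acc => addP [a] (addP acc (mulXP acc))) []

/-- `(X + 1)² · p`. -/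
def sq1P (p : List ℤ) : List ℤ := addP p (addP (mulXP (smulP 2 p)) (mulXP (mulXP p)))

/-- CERTIFICATE of `p > 0` on `[1, ∞)`: all Taylor coefficients at `1` are `≥ 0` and `p(1) > 0`. -/
def certPos (p : List ℤ) : Bool :=
  ((shift1P p).all fun c => decide (0 ≤ c)) && decide (0 < (shift1P p).headD 0)

/-- `hornerG [] ν = 0` (definitional; local copy). -/
theorem hornerG_nil' (ν : R) : hornerG [] ν = 0 := rfl
/-- `hornerG (c :: cs) ν = c + ν · hornerG cs ν` (definitional; local copy). -/
theorem hornerG_cons' (c : ℤ) (cs : List ℤ) (ν : R) : hornerG (c :: cs) ν = (c : R) + ν * hornerG cs ν := rfl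

/-- `hornerG` is additive in the coefficient list. -/
theorem hornerG_addP (p q : List ℤ) (ν : R) : hornerG (addP p q) ν = hornerG p ν + hornerG q ν := by
  induction p generalizing q with
  | nil => rw [addP, hornerG_nil', zero_add]
  | cons a p ih =>
    cases q with
    | nil => rw [addP, hornerG_nil', add_zero]
    | cons b q => rw [addP, hornerG_cons', hornerG_cons', hornerG_cons', ih, Int.cast_add]; ring

/-- `hornerG` commutes with integer scalars. -/
theorem hornerG_smulP (c : ℤ) (p : List ℤ) (ν : R) : hornerG (smulP c p) ν = (c : R) * hornerG p ν := by
  induction p with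
  | nil => simp [smulP, hornerG_nil']
  | cons a p ih =>
    have : smulP c (a :: p) = (c * a) :: smulP c p := rfl
    rw [this, hornerG_cons', hornerG_cons', ih, Int.cast_mul]; ring

/-- `hornerG (X · p) ν = ν · hornerG p ν`. -/
theorem hornerG_mulXP (p : List ℤ) (ν : R) : hornerG (mulXP p) ν = ν * hornerG p ν := by
  rw [mulXP, hornerG_cons', Int.cast_zero, zero_add]

/-- `hornerG (shift1P p) t = hornerG p (t + 1)` (Taylor shift). -/
theorem hornerG_shift1P (p : List ℤ) (t : R) : hornerG (shift1P p) t = hornerG p (t + 1) := by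
  induction p with
  | nil => simp [shift1P, hornerG_nil']
  | cons a p ih =>
    have : shift1P (a :: p) = addP [a] (addP (shift1P p) (mulXP (shift1P p))) := rfl
    rw [this, hornerG_addP, hornerG_addP, hornerG_mulXP, ih, hornerG_cons', hornerG_cons', hornerG_nil']; ring

/-- `hornerG (sq1P p) ν = (ν + 1)² · hornerG p ν`. -/
theorem hornerG_sq1P (p : List ℤ) (ν : R) : hornerG (sq1P p) ν = (ν + 1) ^ 2 * hornerG p ν := by
  rw [sq1P, hornerG_addP, hornerG_addP, hornerG_mulXP, hornerG_mulXP, hornerG_mulXP, hornerG_smulP, Int.cast_ofNat]; ring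

/-- A list with non-negative coefficients evaluates, at `t ≥ 0`, to a value `≥ 0` and `≥` its constant term. -/
theorem hornerG_nonneg_of_all {q : List ℤ} (hq : (q.all fun c => decide (0 ≤ c)) = true) {t : ℚ} (ht : 0 ≤ t) :
    0 ≤ hornerG q t ∧ ((q.headD 0 : ℤ) : ℚ) ≤ hornerG q t := by
  induction q with
  | nil => simp [hornerG_nil']
  | cons a q ih =>
    simp only [List.all_cons, Bool.and_eq_true, decide_eq_true_eq] at hq
    obtain ⟨ha, hq'⟩ := hq
    have ih' := (ih hq').1
    have h0 : (0 : ℚ) ≤ (a : ℚ) := by exact_mod_cast ha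
    rw [hornerG_cons', List.headD_cons]
    have hm : 0 ≤ t * hornerG q t := mul_nonneg ht ih'
    constructor <;> linarith

/-- Soundness of the certificate: `p(ν) > 0` for every rational `ν ≥ 1`. -/
theorem pos_of_certPos {p : List ℤ} (h : certPos p = true) {ν : ℚ} (hν : 1 ≤ ν) : 0 < hornerG p ν := by
  simp only [certPos, Bool.and_eq_true, decide_eq_true_eq] at h
  obtain ⟨hall, hhead⟩ := h
  have ht : (0 : ℚ) ≤ ν - 1 := by linarith
  have key := (hornerG_nonneg_of_all hall ht).2
  rw [hornerG_shift1P, sub_add_cancel] at key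
  have h0 : (0 : ℚ) < (((shift1P p).headD 0 : ℤ) : ℚ) := by exact_mod_cast hhead
  linarith

/-! #### G.2 the image forms and the 24 vertex polynomials -/

/-- `z_i(ν; r₁, r₂) = P̂_{i0}(ν) − r₁ν² P̂_{i1}(ν) + r₁r₂ν⁴ P̂_{i2}(ν)`: the image `P̂(ν)·(1, −r₁ν², r₁r₂ν⁴)`. -/
def zV0 (ν r₁ r₂ : ℚ) : ℚ := hornerG ph00 ν - r₁ * ν ^ 2 * hornerG ph01 ν + r₁ * r₂ * ν ^ 4 * hornerG ph02 ν
/-- Row 1 of the image `P̂(ν)·(1, −r₁ν², r₁r₂ν⁴)`. -/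
def zV1 (ν r₁ r₂ : ℚ) : ℚ := hornerG ph10 ν - r₁ * ν ^ 2 * hornerG ph11 ν + r₁ * r₂ * ν ^ 4 * hornerG ph12 ν
/-- Row 2 of the image `P̂(ν)·(1, −r₁ν², r₁r₂ν⁴)`. -/
def zV2 (ν r₁ r₂ : ℚ) : ℚ := hornerG ph20 ν - r₁ * ν ^ 2 * hornerG ph21 ν + r₁ * r₂ * ν ^ 4 * hornerG ph22 ν

/-- the same as integer list polynomials in `ν`, at integer `(R₁, R₂)` -/
def zP0 (R₁ R₂ : ℤ) : List ℤ :=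
  addP ph00 (addP (smulP (-R₁) (mulXP (mulXP ph01))) (smulP (R₁ * R₂) (mulXP (mulXP (mulXP (mulXP ph02))))))
/-- Row 1 of the image as an integer list polynomial in `ν`, at integer `(R₁, R₂)`. -/
def zP1 (R₁ R₂ : ℤ) : List ℤ :=
  addP ph10 (addP (smulP (-R₁) (mulXP (mulXP ph11))) (smulP (R₁ * R₂) (mulXP (mulXP (mulXP (mulXP ph12))))))
/-- Row 2 of the image as an integer list polynomial in `ν`, at integer `(R₁, R₂)`. -/
def zP2 (R₁ R₂ : ℤ) : List ℤ :=
  addP ph20 (addP (smulP (-R₁) (mulXP (mulXP ph21))) (smulP (R₁ * R₂) (mulXP (mulXP (mulXP (mulXP ph22))))))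

/-- The six forms whose positivity is membership of the image in `PBox (ν+1)`:
`−z₀ > 0`, `z₁ > 0`, `z₁ + 99(ν+1)²z₀ ≥ 0`, `−z₁ − 100(ν+1)²z₀ ≥ 0`, `−z₂ − 80(ν+1)²z₁ ≥ 0`, `z₂ + 100(ν+1)²z₁ ≥ 0`. -/
def formV0 (ν r₁ r₂ : ℚ) : ℚ := -zV0 ν r₁ r₂
/-- Vertex form 1 of the cone step (see the list above `formV0`). -/
def formV1 (ν r₁ r₂ : ℚ) : ℚ := zV1 ν r₁ r₂
/-- Vertex form 2 of the cone step (see the list above `formV0`). -/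
def formV2 (ν r₁ r₂ : ℚ) : ℚ := zV1 ν r₁ r₂ + 99 * (ν + 1) ^ 2 * zV0 ν r₁ r₂
/-- Vertex form 3 of the cone step (see the list above `formV0`). -/
def formV3 (ν r₁ r₂ : ℚ) : ℚ := -zV1 ν r₁ r₂ - 100 * (ν + 1) ^ 2 * zV0 ν r₁ r₂
/-- Vertex form 4 of the cone step (see the list above `formV0`). -/
def formV4 (ν r₁ r₂ : ℚ) : ℚ := -zV2 ν r₁ r₂ - 80 * (ν + 1) ^ 2 * zV1 ν r₁ r₂
/-- Vertex form 5 of the cone step (see the list above `formV0`). -/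
def formV5 (ν r₁ r₂ : ℚ) : ℚ := zV2 ν r₁ r₂ + 100 * (ν + 1) ^ 2 * zV1 ν r₁ r₂

/-- Vertex form 0 as an integer list polynomial in `ν` at integer `(R₁, R₂)`. -/
def formP0 (R₁ R₂ : ℤ) : List ℤ := smulP (-1) (zP0 R₁ R₂)
/-- Vertex form 1 as an integer list polynomial in `ν` at integer `(R₁, R₂)`. -/
def formP1 (R₁ R₂ : ℤ) : List ℤ := zP1 R₁ R₂
/-- Vertex form 2 as an integer list polynomial in `ν` at integer `(R₁, R₂)`. -/
def formP2 (R₁ R₂ : ℤ) : List ℤ := addP (zP1 R₁ R₂) (smulP 99 (sq1P (zP0 R₁ R₂)))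
/-- Vertex form 3 as an integer list polynomial in `ν` at integer `(R₁, R₂)`. -/
def formP3 (R₁ R₂ : ℤ) : List ℤ := addP (smulP (-1) (zP1 R₁ R₂)) (smulP (-100) (sq1P (zP0 R₁ R₂)))
/-- Vertex form 4 as an integer list polynomial in `ν` at integer `(R₁, R₂)`. -/
def formP4 (R₁ R₂ : ℤ) : List ℤ := addP (smulP (-1) (zP2 R₁ R₂)) (smulP (-80) (sq1P (zP1 R₁ R₂)))
/-- Vertex form 5 as an integer list polynomial in `ν` at integer `(R₁, R₂)`. -/
def formP5 (R₁ R₂ : ℤ) : List ℤ := addP (zP2 R₁ R₂) (smulP 100 (sq1P (zP1 R₁ R₂)))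

/-- `formP0` evaluates to `formV0` (semantics of the list arithmetic). -/
theorem hornerG_formP0 (R₁ R₂ : ℤ) (ν : ℚ) : hornerG (formP0 R₁ R₂) ν = formV0 ν R₁ R₂ := by
  simp only [formP0, formV0, zP0, zV0, hornerG_addP, hornerG_smulP, hornerG_mulXP]
  push_cast; ring
/-- `formP1` evaluates to `formV1` (semantics of the list arithmetic). -/
theorem hornerG_formP1 (R₁ R₂ : ℤ) (ν : ℚ) : hornerG (formP1 R₁ R₂) ν = formV1 ν R₁ R₂ := by
  simp only [formP1, formV1, zP1, zV1, hornerG_addP, hornerG_smulP, hornerG_mulXP]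
  push_cast; ring
/-- `formP2` evaluates to `formV2` (semantics of the list arithmetic). -/
theorem hornerG_formP2 (R₁ R₂ : ℤ) (ν : ℚ) : hornerG (formP2 R₁ R₂) ν = formV2 ν R₁ R₂ := by
  simp only [formP2, formV2, zP0, zP1, zV0, zV1, hornerG_sq1P, hornerG_addP, hornerG_smulP, hornerG_mulXP]
  push_cast; ring
/-- `formP3` evaluates to `formV3` (semantics of the list arithmetic). -/
theorem hornerG_formP3 (R₁ R₂ : ℤ) (ν : ℚ) : hornerG (formP3 R₁ R₂) ν = formV3 ν R₁ R₂ := by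
  simp only [formP3, formV3, zP0, zP1, zV0, zV1, hornerG_sq1P, hornerG_addP, hornerG_smulP, hornerG_mulXP]
  push_cast; ring
/-- `formP4` evaluates to `formV4` (semantics of the list arithmetic). -/
theorem hornerG_formP4 (R₁ R₂ : ℤ) (ν : ℚ) : hornerG (formP4 R₁ R₂) ν = formV4 ν R₁ R₂ := by
  simp only [formP4, formV4, zP1, zP2, zV1, zV2, hornerG_sq1P, hornerG_addP, hornerG_smulP, hornerG_mulXP]
  push_cast; ring
/-- `formP5` evaluates to `formV5` (semantics of the list arithmetic). -/
theorem hornerG_formP5 (R₁ R₂ : ℤ) (ν : ℚ) : hornerG (formP5 R₁ R₂) ν = formV5 ν R₁ R₂ := by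
  simp only [formP5, formV5, zP1, zP2, zV1, zV2, hornerG_sq1P, hornerG_addP, hornerG_smulP, hornerG_mulXP]
  push_cast; ring

/-- `formV0` is affine-bilinear in `(r₁, r₁r₂)`: interpolation from `(0,0), (1,0), (1,1)`. -/
theorem formV0_bilin (ν r₁ r₂ : ℚ) : formV0 ν r₁ r₂ =
    formV0 ν 0 0 + (formV0 ν 1 0 - formV0 ν 0 0) * r₁ + (formV0 ν 1 1 - formV0 ν 1 0) * r₁ * r₂ := by
  simp only [formV0, zV0]; ring
/-- `formV1` is affine-bilinear in `(r₁, r₁r₂)`: interpolation from `(0,0), (1,0), (1,1)`. -/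
theorem formV1_bilin (ν r₁ r₂ : ℚ) : formV1 ν r₁ r₂ =
    formV1 ν 0 0 + (formV1 ν 1 0 - formV1 ν 0 0) * r₁ + (formV1 ν 1 1 - formV1 ν 1 0) * r₁ * r₂ := by
  simp only [formV1, zV1]; ring
/-- `formV2` is affine-bilinear in `(r₁, r₁r₂)`: interpolation from `(0,0), (1,0), (1,1)`. -/
theorem formV2_bilin (ν r₁ r₂ : ℚ) : formV2 ν r₁ r₂ =
    formV2 ν 0 0 + (formV2 ν 1 0 - formV2 ν 0 0) * r₁ + (formV2 ν 1 1 - formV2 ν 1 0) * r₁ * r₂ := by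
  simp only [formV2, zV0, zV1]; ring
/-- `formV3` is affine-bilinear in `(r₁, r₁r₂)`: interpolation from `(0,0), (1,0), (1,1)`. -/
theorem formV3_bilin (ν r₁ r₂ : ℚ) : formV3 ν r₁ r₂ =
    formV3 ν 0 0 + (formV3 ν 1 0 - formV3 ν 0 0) * r₁ + (formV3 ν 1 1 - formV3 ν 1 0) * r₁ * r₂ := by
  simp only [formV3, zV0, zV1]; ring
/-- `formV4` is affine-bilinear in `(r₁, r₁r₂)`: interpolation from `(0,0), (1,0), (1,1)`. -/
theorem formV4_bilin (ν r₁ r₂ : ℚ) : formV4 ν r₁ r₂ =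
    formV4 ν 0 0 + (formV4 ν 1 0 - formV4 ν 0 0) * r₁ + (formV4 ν 1 1 - formV4 ν 1 0) * r₁ * r₂ := by
  simp only [formV4, zV1, zV2]; ring
/-- `formV5` is affine-bilinear in `(r₁, r₁r₂)`: interpolation from `(0,0), (1,0), (1,1)`. -/
theorem formV5_bilin (ν r₁ r₂ : ℚ) : formV5 ν r₁ r₂ =
    formV5 ν 0 0 + (formV5 ν 1 0 - formV5 ν 0 0) * r₁ + (formV5 ν 1 1 - formV5 ν 1 0) * r₁ * r₂ := by
  simp only [formV5, zV1, zV2]; ring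

end Cone

end Summit.KontsevichZagierPeriods.Zeta5Search.RecordRay.Generic
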